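import Mathlib
import HarnessLib
import Literature.Analysis.FluidPDE.TypeIAncientMild
import Summits.NavierStokesRegularity.NavierStokesRegularity.Theorems.SqueezeCycleExtremalElementExistsExtraction
import Summits.NavierStokesRegularity.NavierStokesRegularity.Theorems.SymmetryModuliCountFarPastLedgerReduction

/-!
# Crux `ExtremalSpiralSymmetry` (stmt-NavierStokesRegularity-8215), line `registered`, towards stub 1 —
# blow-down calculus in the class `A_C`: dense-set upgrade, diagonal extraction, closedness and transitivity

Support file (theorems only, `--supports stmt-NavierStokesRegularity-8215`; no definitions, no named facts). Lead c2.
Part A of the proof that SOME extremal pair is a blow-down of ITSELF (part B: `…SelfRecurrentExtremal.lean`).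

For fields `W, W'` on `ℝ × ℝ³` say `W'` is a BLOW-DOWN of `W` when `λ_j W(λ_j² t, x_j + λ_j x) → W'(t, x)` for all
`t < 0`, `x`, along some scales `λ_j → ∞` and centres `x_j` (written out in every statement; no definition is
introduced). All fields live in one class `A_C = IsTypeIAncientMild C` (Koch–Nadirashvili–Seregin–Šverák's Type-I
ancient mild fields in the Oseen gauge), which is invariant under the renormalisations
`N_{λ,a} W (t,x) = λ W(λ²t, a + λx)` and sequentially compact for pointwise convergence on the open slab
(`exists_tendsto_of_isTypeIAncientMild_seq`). This file proves the soft calculus of that relation: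

* `tendsto_slab_of_tendsto_dense` — for sequences in `A_C` with a limit continuous on the slab, pointwise convergence on
  a DENSE subset of the slab is pointwise convergence everywhere (subsequence principle + compactness + continuity);
* `exists_dense_seq_slab` — a sequence `q : ℕ → slab` with dense range;
* `diagonal_slab` — the diagonal extraction: from a double sequence `M i j ∈ A_C` with `M i j → T i` (`j → ∞`) and
  `T i → T∞` at the points `q n`, and weights `μ i j → ∞` (`j → ∞`), a diagonal `j(i)` with `μ i (j i) → ∞` and
  `M i (j i) → T∞` everywhere on the slab;
* `blowDown_of_tendsto` — blow-downs of `W` form a set closed under pointwise limits in `A_C`;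
* `blowDown_trans` — a blow-down of a blow-down of `W` is a blow-down of `W`;
* `eqOn_slab_of_eq_on_dense_seq` — two fields of the class with the same values at all `q n` agree on the slab.
-/

noncomputable section

-- the summit and its single sub-problem share the name (CONVENTIONS §1), as in every Theorems file
set_option linter.dupNamespace false

open Set MeasureTheory Filter Topology Function
open Literature.Analysis.FluidPDE

namespace Summit.NavierStokesRegularity.NavierStokesRegularity.Theorems.ExtremalSpiralSymmetry.Registered

/-! ### Pointwise convergence on a dense set is pointwise convergence on the slab -/

/-- **Dense-set upgrade.** Let `w_j ∈ A_C`, let `W` be continuous on the open slab `t < 0`, and suppose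
`w_j → W` pointwise on a subset `D` of the slab which is dense in the slab. Then `w_j → W` pointwise at EVERY point of
the slab: every subsequence has (KNSS compactness) a further subsequence converging pointwise on the slab to some
`V ∈ A_C`; `V = W` on `D`, hence on the slab by continuity; so the limit along the sub-subsequence is `W(t,x)`, and the
subsequence principle concludes. [folklore] -/
theorem tendsto_slab_of_tendsto_dense {C : ℝ}
    {w : ℕ → ℝ → EuclideanSpace ℝ (Fin 3) → EuclideanSpace ℝ (Fin 3)}
    {W : ℝ → EuclideanSpace ℝ (Fin 3) → EuclideanSpace ℝ (Fin 3)}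
    (hw : ∀ j, IsTypeIAncientMild C (w j))
    (hW : ContinuousOn (uncurry W) (Iio (0 : ℝ) ×ˢ univ))
    {D : Set (ℝ × EuclideanSpace ℝ (Fin 3))} (hDsub : D ⊆ Iio (0 : ℝ) ×ˢ univ)
    (hD : Iio (0 : ℝ) ×ˢ (univ : Set (EuclideanSpace ℝ (Fin 3))) ⊆ closure D)
    (hconv : ∀ p ∈ D, Tendsto (fun j => w j p.1 p.2) atTop (𝓝 (W p.1 p.2))) :
    ∀ t < (0 : ℝ), ∀ x, Tendsto (fun j => w j t x) atTop (𝓝 (W t x)) := by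
  intro t ht x
  refine tendsto_of_subseq_tendsto fun ψ hψ => ?_
  obtain ⟨φ, hφ, V, hV, hpt, -, -, -⟩ :=
    Summit.NavierStokesRegularity.NavierStokesRegularity.Theorems.exists_tendsto_of_isTypeIAncientMild_seq C
      (fun i => hw (ψ i))
  refine ⟨φ, ?_⟩
  have hVD : EqOn (uncurry V) (uncurry W) D := fun p hp => by
    have h1 : Tendsto (fun i => w (ψ (φ i)) p.1 p.2) atTop (𝓝 (V p.1 p.2)) := hpt p.1 (hDsub hp).1 p.2
    have h2 : Tendsto (fun i => w (ψ (φ i)) p.1 p.2) atTop (𝓝 (W p.1 p.2)) :=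
      ((hconv p hp).comp hψ).comp hφ.tendsto_atTop
    exact tendsto_nhds_unique h1 h2
  have hVW : EqOn (uncurry V) (uncurry W) (Iio (0 : ℝ) ×ˢ univ) :=
    hVD.of_subset_closure hV.continuousOn_uncurry hW hDsub hD
  have key := hpt t ht x
  have e : V t x = W t x := hVW (show ((t, x) : ℝ × EuclideanSpace ℝ (Fin 3)) ∈ Iio (0 : ℝ) ×ˢ univ from
    ⟨ht, mem_univ _⟩)
  rw [e] at key
  exact key

/-- **A dense sequence in the slab.** There is `q : ℕ → ℝ × ℝ³` with all `q n` in the open slab `t < 0` and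
`range q` dense in the slab (the slab is a separable metric space). [folklore] -/
theorem exists_dense_seq_slab :
    ∃ q : ℕ → ℝ × EuclideanSpace ℝ (Fin 3), (∀ n, (q n).1 < 0) ∧
      Iio (0 : ℝ) ×ˢ (univ : Set (EuclideanSpace ℝ (Fin 3))) ⊆ closure (range q) := by
  set S : Set (ℝ × EuclideanSpace ℝ (Fin 3)) := Iio (0 : ℝ) ×ˢ univ with hS
  obtain ⟨D, hDc, hDd⟩ := TopologicalSpace.exists_countable_dense S
  have hSne : S.Nonempty := ⟨((-1 : ℝ), (0 : EuclideanSpace ℝ (Fin 3))), by simp [hS]⟩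
  haveI : Nonempty S := hSne.to_subtype
  have hDne : D.Nonempty := hDd.nonempty
  obtain ⟨f, hf⟩ := hDc.exists_eq_range hDne
  refine ⟨fun n => (f n : ℝ × EuclideanSpace ℝ (Fin 3)), fun n => ?_, fun z hz => ?_⟩
  · have h := (f n).2
    simp only [hS, mem_prod, mem_Iio, mem_univ, and_true] at h
    exact h
  · have hp : (⟨z, hz⟩ : S) ∈ closure D := hDd _
    rw [closure_subtype] at hp
    have e : ((↑) : S → ℝ × EuclideanSpace ℝ (Fin 3)) '' D =
        range (fun n => (f n : ℝ × EuclideanSpace ℝ (Fin 3))) := by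
      rw [hf, ← range_comp]
      rfl
    rw [e] at hp
    exact hp

/-! ### The diagonal extraction -/

/-- **Diagonal extraction in `A_C`.** Let `q` be a dense sequence in the slab, `M i j ∈ A_C` a double sequence with
`M i j → T i` pointwise at the points `q n` as `j → ∞`, `T i → T∞` at the points `q n`, `T∞` continuous on the
slab, and `μ i j → ∞` as `j → ∞` for each `i`. Then some diagonal `j(i)` has `μ i (j i) → ∞` and
`M i (j i) → T∞` pointwise on the whole slab (finitely many `1/(i+1)`-conditions at stage `i`, then the dense-set
upgrade). [folklore] -/
theorem diagonal_slab {C : ℝ} {q : ℕ → ℝ × EuclideanSpace ℝ (Fin 3)} (hq : ∀ n, (q n).1 < 0)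
    (hqd : Iio (0 : ℝ) ×ˢ (univ : Set (EuclideanSpace ℝ (Fin 3))) ⊆ closure (range q))
    {M : ℕ → ℕ → ℝ → EuclideanSpace ℝ (Fin 3) → EuclideanSpace ℝ (Fin 3)}
    (hM : ∀ i j, IsTypeIAncientMild C (M i j))
    {T : ℕ → ℝ → EuclideanSpace ℝ (Fin 3) → EuclideanSpace ℝ (Fin 3)}
    (hT : ∀ i n, Tendsto (fun j => M i j (q n).1 (q n).2) atTop (𝓝 (T i (q n).1 (q n).2)))
    {Tlim : ℝ → EuclideanSpace ℝ (Fin 3) → EuclideanSpace ℝ (Fin 3)}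
    (hTlim : ContinuousOn (uncurry Tlim) (Iio (0 : ℝ) ×ˢ univ))
    (hTT : ∀ n, Tendsto (fun i => T i (q n).1 (q n).2) atTop (𝓝 (Tlim (q n).1 (q n).2)))
    {μ : ℕ → ℕ → ℝ} (hμ : ∀ i, Tendsto (μ i) atTop atTop) :
    ∃ j : ℕ → ℕ, Tendsto (fun i => μ i (j i)) atTop atTop ∧
      ∀ t < (0 : ℝ), ∀ x, Tendsto (fun i => M i (j i) t x) atTop (𝓝 (Tlim t x)) := by
  -- stage `i`: finitely many conditions, each eventually true in `j`
  have hstage : ∀ i : ℕ, ∃ j : ℕ, (∀ n ∈ Finset.range (i + 1),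
      dist (M i j (q n).1 (q n).2) (T i (q n).1 (q n).2) < 1 / ((i : ℝ) + 1)) ∧ (i : ℝ) + 1 < μ i j := by
    intro i
    have h1 : ∀ᶠ j in atTop, ∀ n ∈ Finset.range (i + 1),
        dist (M i j (q n).1 (q n).2) (T i (q n).1 (q n).2) < 1 / ((i : ℝ) + 1) := by
      refine (Finset.eventually_all _).2 fun n _ => ?_
      exact Metric.tendsto_nhds.1 (hT i n) _ (by positivity)
    have h2 : ∀ᶠ j in atTop, (i : ℝ) + 1 < μ i j := (hμ i).eventually (eventually_gt_atTop _)
    exact (h1.and h2).exists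
  choose j hj using hstage
  refine ⟨j, ?_, ?_⟩
  · refine tendsto_atTop_mono (fun i => (hj i).2.le) ?_
    exact tendsto_atTop_add_const_right _ 1 tendsto_natCast_atTop_atTop
  · -- convergence at the points `q n`, then the dense-set upgrade
    have hqn : ∀ n, Tendsto (fun i => M i (j i) (q n).1 (q n).2) atTop (𝓝 (Tlim (q n).1 (q n).2)) := by
      intro n
      rw [tendsto_iff_dist_tendsto_zero]
      have hbound : ∀ᶠ i in atTop, dist (M i (j i) (q n).1 (q n).2) (Tlim (q n).1 (q n).2) ≤
          1 / ((i : ℝ) + 1) + dist (T i (q n).1 (q n).2) (Tlim (q n).1 (q n).2) := by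
        refine (eventually_ge_atTop n).mono fun i hi => ?_
        have h := (hj i).1 n (Finset.mem_range.2 (Nat.lt_succ_of_le hi))
        linarith [dist_triangle (M i (j i) (q n).1 (q n).2) (T i (q n).1 (q n).2) (Tlim (q n).1 (q n).2)]
      have hlim : Tendsto (fun i : ℕ => 1 / ((i : ℝ) + 1) + dist (T i (q n).1 (q n).2) (Tlim (q n).1 (q n).2))
          atTop (𝓝 (0 + 0)) := by
        refine Tendsto.add ?_ ?_
        · have h1 : Tendsto (fun i : ℕ => (i : ℝ) + 1) atTop atTop :=
            tendsto_atTop_add_const_right _ 1 tendsto_natCast_atTop_atTop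
          simpa [Function.comp_def, one_div] using tendsto_inv_atTop_zero.comp h1
        · exact (tendsto_iff_dist_tendsto_zero.1 (hTT n))
      rw [add_zero] at hlim
      exact tendsto_of_tendsto_of_tendsto_of_le_of_le' tendsto_const_nhds hlim
        (Eventually.of_forall fun i => dist_nonneg) hbound
    refine tendsto_slab_of_tendsto_dense (fun i => hM i (j i)) hTlim (D := range q) ?_ hqd ?_
    · rintro p ⟨n, rfl⟩
      exact ⟨hq n, mem_univ _⟩
    · rintro p ⟨n, rfl⟩
      exact hqn n

/-! ### Closedness and transitivity of the blow-down relation -/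

/-- Renormalisations stay in the class: `(t, x) ↦ λ W(λ²t, a + λx)` lies in `A_C` for `W ∈ A_C`, `λ > 0`.
[cite: KochNadirashviliSereginSverak2009, §1 p. 3 (arXiv:0709.3599)] -/
theorem isTypeIAncientMild_renorm {C : ℝ} {W : ℝ → EuclideanSpace ℝ (Fin 3) → EuclideanSpace ℝ (Fin 3)}
    (hW : IsTypeIAncientMild C W) {lam : ℝ} (hlam : 0 < lam) (a : EuclideanSpace ℝ (Fin 3)) :
    IsTypeIAncientMild C (fun t x => lam • W (lam ^ 2 * t) (a + lam • x)) := by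
  have h := Summit.NavierStokesRegularity.NavierStokesRegularity.Theorems.isTypeIAncientMild_nsRescale
    (Summit.NavierStokesRegularity.NavierStokesRegularity.Theorems.isTypeIAncientMild_translate hW a) hlam
  have e : nsRescale lam (fun t x => W t (a + x)) = fun t x => lam • W (lam ^ 2 * t) (a + lam • x) := by
    funext t x
    simp [nsRescale_apply]
  rwa [e] at h

/-- **Blow-downs are closed under pointwise limits.** Let `W ∈ A_C`, let each `W'_i ∈ A_C` be a blow-down of `W`,
and let `W'_i → W'` pointwise on the slab with `W' ∈ A_C`. Then `W'` is a blow-down of `W` (diagonal extraction).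
[folklore] -/
theorem blowDown_of_tendsto {C : ℝ}
    {W : ℝ → EuclideanSpace ℝ (Fin 3) → EuclideanSpace ℝ (Fin 3)} (hW : IsTypeIAncientMild C W)
    {W' : ℕ → ℝ → EuclideanSpace ℝ (Fin 3) → EuclideanSpace ℝ (Fin 3)}
    (hbd : ∀ i, ∃ (lam : ℕ → ℝ) (xs : ℕ → EuclideanSpace ℝ (Fin 3)), (∀ j, 0 < lam j) ∧
      Tendsto lam atTop atTop ∧
      ∀ t < (0 : ℝ), ∀ x, Tendsto (fun j => lam j • W (lam j ^ 2 * t) (xs j + lam j • x)) atTop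
        (𝓝 (W' i t x)))
    {Wlim : ℝ → EuclideanSpace ℝ (Fin 3) → EuclideanSpace ℝ (Fin 3)} (hWlim : IsTypeIAncientMild C Wlim)
    (hlim : ∀ t < (0 : ℝ), ∀ x, Tendsto (fun i => W' i t x) atTop (𝓝 (Wlim t x))) :
    ∃ (lam : ℕ → ℝ) (xs : ℕ → EuclideanSpace ℝ (Fin 3)), (∀ j, 0 < lam j) ∧ Tendsto lam atTop atTop ∧
      ∀ t < (0 : ℝ), ∀ x, Tendsto (fun j => lam j • W (lam j ^ 2 * t) (xs j + lam j • x)) atTop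
        (𝓝 (Wlim t x)) := by
  obtain ⟨q, hq, hqd⟩ := exists_dense_seq_slab
  choose lam xs hpos htop hconv using hbd
  obtain ⟨j, hj, hjc⟩ := diagonal_slab (C := C) hq hqd
    (M := fun i j => fun t x => lam i j • W (lam i j ^ 2 * t) (xs i j + lam i j • x))
    (fun i j => isTypeIAncientMild_renorm hW (hpos i j) (xs i j))
    (T := W') (fun i n => hconv i (q n).1 (hq n) (q n).2)
    hWlim.continuousOn_uncurry (fun n => hlim (q n).1 (hq n) (q n).2) (μ := lam) htop
  exact ⟨fun i => lam i (j i), fun i => xs i (j i), fun i => hpos i (j i), hj, hjc⟩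

/-- **Transitivity of blow-downs.** If `W' ∈ A_C` is a blow-down of `W ∈ A_C` and `W'' ∈ A_C` is a blow-down of `W'`,
then `W''` is a blow-down of `W`: renormalisation commutes with pointwise limits and composes
(`N_{λ',a'} N_{λ,a} = N_{λλ', a + λa'}`), so `N_{λ'_i,a'_i} W' = lim_j N_{λ_jλ'_i, a_j + λ_j a'_i} W`, and a diagonal
does it. [folklore] -/
theorem blowDown_trans {C : ℝ}
    {W W' W'' : ℝ → EuclideanSpace ℝ (Fin 3) → EuclideanSpace ℝ (Fin 3)} (hW : IsTypeIAncientMild C W)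
    (hW'' : IsTypeIAncientMild C W'')
    (h1 : ∃ (lam : ℕ → ℝ) (xs : ℕ → EuclideanSpace ℝ (Fin 3)), (∀ j, 0 < lam j) ∧ Tendsto lam atTop atTop ∧
      ∀ t < (0 : ℝ), ∀ x, Tendsto (fun j => lam j • W (lam j ^ 2 * t) (xs j + lam j • x)) atTop
        (𝓝 (W' t x)))
    (h2 : ∃ (lam : ℕ → ℝ) (xs : ℕ → EuclideanSpace ℝ (Fin 3)), (∀ j, 0 < lam j) ∧ Tendsto lam atTop atTop ∧
      ∀ t < (0 : ℝ), ∀ x, Tendsto (fun j => lam j • W' (lam j ^ 2 * t) (xs j + lam j • x)) atTop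
        (𝓝 (W'' t x))) :
    ∃ (lam : ℕ → ℝ) (xs : ℕ → EuclideanSpace ℝ (Fin 3)), (∀ j, 0 < lam j) ∧ Tendsto lam atTop atTop ∧
      ∀ t < (0 : ℝ), ∀ x, Tendsto (fun j => lam j • W (lam j ^ 2 * t) (xs j + lam j • x)) atTop
        (𝓝 (W'' t x)) := by
  obtain ⟨q, hq, hqd⟩ := exists_dense_seq_slab
  obtain ⟨lam, xs, hpos, htop, hconv⟩ := h1
  obtain ⟨lam', xs', hpos', htop', hconv'⟩ := h2
  -- the composed renormalisations and their pointwise limits `N'_i W'`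
  have halg : ∀ i j t x, (lam j * lam' i) • W ((lam j * lam' i) ^ 2 * t) (xs j + lam j • xs' i +
      (lam j * lam' i) • x) = lam' i • (lam j • W (lam j ^ 2 * (lam' i ^ 2 * t))
        (xs j + lam j • (xs' i + lam' i • x))) := by
    intro i j t x
    have e1 : (lam j * lam' i) ^ 2 * t = lam j ^ 2 * (lam' i ^ 2 * t) := by ring
    have e2 : xs j + lam j • xs' i + (lam j * lam' i) • x = xs j + lam j • (xs' i + lam' i • x) := by
      rw [smul_add, smul_smul, add_assoc]
    rw [smul_smul, mul_comm (lam' i) (lam j), e1, e2]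
  have hT : ∀ i n, Tendsto (fun j => (lam j * lam' i) • W ((lam j * lam' i) ^ 2 * (q n).1)
      (xs j + lam j • xs' i + (lam j * lam' i) • (q n).2)) atTop
      (𝓝 (lam' i • W' (lam' i ^ 2 * (q n).1) (xs' i + lam' i • (q n).2))) := by
    intro i n
    have ht' : lam' i ^ 2 * (q n).1 < 0 := mul_neg_of_pos_of_neg (pow_pos (hpos' i) 2) (hq n)
    have h := (hconv (lam' i ^ 2 * (q n).1) ht' (xs' i + lam' i • (q n).2)).const_smul (lam' i)
    simp only [halg]
    exact h
  obtain ⟨j, hj, hjc⟩ := diagonal_slab (C := C) hq hqd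
    (M := fun i j => fun t x => (lam j * lam' i) • W ((lam j * lam' i) ^ 2 * t)
      (xs j + lam j • xs' i + (lam j * lam' i) • x))
    (fun i j => isTypeIAncientMild_renorm hW (mul_pos (hpos j) (hpos' i)) _)
    (T := fun i => fun t x => lam' i • W' (lam' i ^ 2 * t) (xs' i + lam' i • x)) hT
    hW''.continuousOn_uncurry (fun n => hconv' (q n).1 (hq n) (q n).2)
    (μ := fun i j => lam j * lam' i) (fun i => htop.atTop_mul_const (hpos' i))
  exact ⟨fun i => lam (j i) * lam' i, fun i => xs (j i) + lam (j i) • xs' i,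
    fun i => mul_pos (hpos _) (hpos' _), hj, hjc⟩

/-- **Fields of the class with the same values on a dense sequence agree on the slab** (continuity on the open
slab). [folklore] -/
theorem eqOn_slab_of_eq_on_dense_seq {C : ℝ} {q : ℕ → ℝ × EuclideanSpace ℝ (Fin 3)}
    (hq : ∀ n, (q n).1 < 0)
    (hqd : Iio (0 : ℝ) ×ˢ (univ : Set (EuclideanSpace ℝ (Fin 3))) ⊆ closure (range q))
    {W₁ W₂ : ℝ → EuclideanSpace ℝ (Fin 3) → EuclideanSpace ℝ (Fin 3)}
    (h₁ : IsTypeIAncientMild C W₁) (h₂ : IsTypeIAncientMild C W₂)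
    (heq : ∀ n, W₁ (q n).1 (q n).2 = W₂ (q n).1 (q n).2) :
    ∀ t < (0 : ℝ), ∀ x, W₁ t x = W₂ t x := by
  have hD : EqOn (uncurry W₁) (uncurry W₂) (range q) := by
    rintro p ⟨n, rfl⟩
    exact heq n
  have hsub : range q ⊆ Iio (0 : ℝ) ×ˢ (univ : Set (EuclideanSpace ℝ (Fin 3))) := by
    rintro p ⟨n, rfl⟩
    exact ⟨hq n, mem_univ _⟩
  have h := hD.of_subset_closure h₁.continuousOn_uncurry h₂.continuousOn_uncurry hsub hqd
  intro t ht x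
  exact h (show ((t, x) : ℝ × EuclideanSpace ℝ (Fin 3)) ∈ Iio (0 : ℝ) ×ˢ univ from ⟨ht, mem_univ _⟩)

/-- **Transitivity of blow-downs (registered form).** `blowDown_trans` with explicit binders: a blow-down of a
blow-down of `W ∈ A_C` is a blow-down of `W`. [folklore] -/
theorem blowDown_transitive :
    ∀ (C : ℝ) (W W' W'' : ℝ → EuclideanSpace ℝ (Fin 3) → EuclideanSpace ℝ (Fin 3)),
      IsTypeIAncientMild C W → IsTypeIAncientMild C W'' →
      (∃ (lam : ℕ → ℝ) (xs : ℕ → EuclideanSpace ℝ (Fin 3)), (∀ j, 0 < lam j) ∧ Tendsto lam atTop atTop ∧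
        ∀ t < (0 : ℝ), ∀ x, Tendsto (fun j => lam j • W (lam j ^ 2 * t) (xs j + lam j • x)) atTop
          (𝓝 (W' t x))) →
      (∃ (lam : ℕ → ℝ) (xs : ℕ → EuclideanSpace ℝ (Fin 3)), (∀ j, 0 < lam j) ∧ Tendsto lam atTop atTop ∧
        ∀ t < (0 : ℝ), ∀ x, Tendsto (fun j => lam j • W' (lam j ^ 2 * t) (xs j + lam j • x)) atTop
          (𝓝 (W'' t x))) →
      ∃ (lam : ℕ → ℝ) (xs : ℕ → EuclideanSpace ℝ (Fin 3)), (∀ j, 0 < lam j) ∧ Tendsto lam atTop atTop ∧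
        ∀ t < (0 : ℝ), ∀ x, Tendsto (fun j => lam j • W (lam j ^ 2 * t) (xs j + lam j • x)) atTop
          (𝓝 (W'' t x)) :=
  fun _ _ _ _ hW hW'' h1 h2 => blowDown_trans hW hW'' h1 h2

end Summit.NavierStokesRegularity.NavierStokesRegularity.Theorems.ExtremalSpiralSymmetry.Registered

end
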